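import Summits.QuantumFields.YangMills.Theorems.ColdStartUniversalityLatticeLangevinLiebRobinsonPathwise
import Summits.QuantumFields.YangMills.Theorems.ColdStartUniversalityUniformColdStartMixingRungOfHarris
import HarnessLib

/-!
# Route `ColdStartUniversality` (fixed-cut-off SZZ dynamics; LIEB–ROBINSON / LOCALITY package, file 4):
# ★★★ THE LIEB–ROBINSON BOUND FOR THE SZZ SEMIGROUP — link-Lipschitz profiles propagate with exponential tails

Helper file (seat `ym-line-csu-p1`, g30; `--supports stmt-QuantumFields-24809`).  Consumable, kernel-language form of the pathwise
Lieb–Robinson bound (`…LiebRobinsonPathwise`), for ANY Markov kernel family `κ` realising the transition laws of the `SU(2)` SZZ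
dynamics on `(ℤ/L)³` at coupling `β'` (the hypothesis `hreal` of the tree's fixed-cut-off semigroup package):
* `abs_sub_le_sum_linkLipschitz` — telescoping: per-link Lipschitz constants `ℓ_e` (Frobenius distance of the link matrices) give
  `|F(y) − F(y')| ≤ Σ_e ℓ_e ‖y_e − y'_e‖_F`;
* ★★★ `transitionKernel_liebRobinson` — for every weight `w > 0` with `w_e ≤ K·w_f` across plaquettes, every continuous `F` with link
  profile `ℓ`, all starts `x, x'`, every lattice time `t`:
  `|κ_t F(x) − κ_t F(x')| ≤ e^{|β'|(4+4√2+12K)t} · (Σ_e ℓ_e/w_e) · Σ_f w_f ‖x_f − x'_f‖_F`.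
  With `w_f = K^{d(f,e₀)}` (graph distance through plaquettes) and `x, x'` differing at the single link `e₀`: the Lipschitz constant of
  `κ_t F` in the link `e₀` is at most `e^{|β'|(4+4√2+12K)t} Σ_e ℓ_e K^{−d(e,e₀)}`; for a LOCAL `F` (profile supported in `Λ`) this is
  `e^{|β'|(4+4√2+12K)t − (log K) d(e₀,Λ)} Σ_e ℓ_e` — exponentially small outside the light cone `d(e₀,Λ) ≲ |β'|(4+4√2+12K) t / log K`,
  uniformly in `L` (Shen–Zhu–Zhu arXiv:2204.12737 §4.3 prove the `L^∞`-gradient version (4.13) of this locality by commutator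
  iteration; here it comes pathwise from the Doss–Sussmann representation, with no spatial derivatives of the semigroup).
THEOREMS ONLY, no definition, no sorry; [folklore] / [cite: ShenZhuZhu2022, §4.3 (eq:com)].  HONEST FRAMING: fixed cut-off, any
coupling; the light-cone speed grows like `|β'|`, so along the route's scaling `β'_K = (γε_K)⁻¹/2 → ∞` nothing here is `K`-uniform in
physical units; no crux, rung or summit statement is proved; the Yang–Mills mass gap is NOT proved.
-/

set_option autoImplicit false

noncomputable section

namespace Summit.QuantumFields.YangMills.Theorems.ColdStartUniversality.LiebRobinson

open MeasureTheory Matrix Finset Set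
open scoped BigOperators Matrix ComplexConjugate NNReal Topology
open Literature.MathematicalPhysics.QuantumFieldTheory Literature.Probability.Process
open Literature.MathematicalPhysics.QuantumLattice (fundamentalRep fundamentalLatticeRep)

/-! ## §1. From per-link to global Lipschitz bounds (telescoping one link at a time) -/

section Telescoping

variable {L : ℕ} [NeZero L]

/-- **Telescoping over links.**  If `F` is `ℓ_e`-Lipschitz in the link `e` (Frobenius distance of the link matrices, all other links
frozen) for every `e`, then `|F(y) − F(y')| ≤ Σ_e ℓ_e ‖y_e − y'_e‖_F` for ALL pairs of configurations (change the links one at a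
time; induction on the set of links where `y, y'` may differ). [folklore] -/
theorem abs_sub_le_sum_linkLipschitz {F : GaugeConfig 3 L (Matrix.specialUnitaryGroup (Fin 2) ℂ) → ℝ} (ℓ : Edge 3 L → ℝ)
    (hF : ∀ (e : Edge 3 L) (y y' : GaugeConfig 3 L (Matrix.specialUnitaryGroup (Fin 2) ℂ)), (∀ f, f ≠ e → y f = y' f) →
      |F y - F y'| ≤ ℓ e * frobNorm ((y e : Matrix (Fin 2) (Fin 2) ℂ) - (y' e : Matrix (Fin 2) (Fin 2) ℂ)))
    (y y' : GaugeConfig 3 L (Matrix.specialUnitaryGroup (Fin 2) ℂ)) :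
    |F y - F y'| ≤ ∑ e, ℓ e * frobNorm ((y e : Matrix (Fin 2) (Fin 2) ℂ) - (y' e : Matrix (Fin 2) (Fin 2) ℂ)) := by
  classical
  -- induction on a finset `s` outside of which the two configurations agree
  have key : ∀ (s : Finset (Edge 3 L)) (y y' : GaugeConfig 3 L (Matrix.specialUnitaryGroup (Fin 2) ℂ)),
      (∀ f, f ∉ s → y f = y' f) →
      |F y - F y'| ≤ ∑ e ∈ s, ℓ e * frobNorm ((y e : Matrix (Fin 2) (Fin 2) ℂ) - (y' e : Matrix (Fin 2) (Fin 2) ℂ)) := by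
    intro s
    induction s using Finset.induction_on with
    | empty =>
      intro y y' h
      have hyy : y = y' := funext fun f => h f (by simp)
      simp [hyy]
    | @insert a s ha ih =>
      intro y y' h
      -- intermediate configuration: `y` with the link `a` replaced by `y' a`
      set y'' : GaugeConfig 3 L (Matrix.specialUnitaryGroup (Fin 2) ℂ) := Function.update y a (y' a) with hy''
      have h1 : ∀ f, f ≠ a → y f = y'' f := fun f hf => by rw [hy'', Function.update_of_ne hf]
      have h2 : ∀ f, f ∉ s → y'' f = y' f := by
        intro f hf
        by_cases hfa : f = a
        · subst hfa; rw [hy'', Function.update_self]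
        · rw [hy'', Function.update_of_ne hfa]
          exact h f (by simp [hfa, hf])
      have hstep : |F y - F y''| ≤ ℓ a * frobNorm ((y a : Matrix (Fin 2) (Fin 2) ℂ) - (y' a : Matrix (Fin 2) (Fin 2) ℂ)) := by
        have h := hF a y y'' h1
        rwa [hy'', Function.update_self] at h
      have hrest := ih y'' y' h2
      have hsame : ∑ e ∈ s, ℓ e * frobNorm ((y'' e : Matrix (Fin 2) (Fin 2) ℂ) - (y' e : Matrix (Fin 2) (Fin 2) ℂ)) =
          ∑ e ∈ s, ℓ e * frobNorm ((y e : Matrix (Fin 2) (Fin 2) ℂ) - (y' e : Matrix (Fin 2) (Fin 2) ℂ)) := by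
        refine Finset.sum_congr rfl fun e he => ?_
        have hea : e ≠ a := fun h => ha (h ▸ he)
        rw [← h1 e hea]
      rw [Finset.sum_insert ha]
      calc |F y - F y'| = |(F y - F y'') + (F y'' - F y')| := by ring_nf
        _ ≤ |F y - F y''| + |F y'' - F y'| := abs_add_le _ _
        _ ≤ _ := by rw [hsame] at hrest; exact add_le_add hstep hrest
  exact key Finset.univ y y' fun f hf => absurd (Finset.mem_univ f) hf

end Telescoping

/-! ## §2. The Lieb–Robinson bound for the transition kernels -/

section Semigroup

variable {L : ℕ} [NeZero L]

/-- ★★★ **LIEB–ROBINSON BOUND FOR THE SZZ SEMIGROUP: link-Lipschitz profiles propagate with exponentially decaying tails.**  Let `κ` be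
any Markov kernel family realising the transition laws of the `SU(2)` SZZ dynamics on `(ℤ/L)³` at coupling `β'` (ANY coupling, ANY
volume), `w > 0` a weight on links with `w_e ≤ K·w_f` across plaquettes (`K ≥ 0`), and `F` a continuous observable which is
`ℓ_e`-Lipschitz in the link `e` (Frobenius distance) for every `e`.  Then for all starts `x, x'` and every lattice time `t`:
`|κ_t F(x) − κ_t F(x')| ≤ e^{|β'|(4+4√2+12K)t} · (Σ_e ℓ_e/w_e) · Σ_f w_f ‖x_f − x'_f‖_F`.
Reading: with `w_f = K^{d(f,e₀)}` and `x, x'` differing only at the link `e₀`, the Lipschitz constant of `κ_t F` in the link `e₀` is at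
most `e^{|β'|(4+4√2+12K)t} Σ_e ℓ_e K^{−d(e,e₀)}` — for a LOCAL observable (`ℓ` supported in a set `Λ` of links) this is
`e^{|β'|(4+4√2+12K)t − (log K)·d(e₀,Λ)} Σ_e ℓ_e`: outside the «light cone» `d ≲ |β'|(4+4√2+12K)t/log K` the dependence of `κ_t F` on
the start decays exponentially, uniformly in the volume.  Proof: `exists_solutionFamily_liebRobinson` (pathwise bound, a.s.),
telescoping, `|E[·]| ≤ E|·|`. [folklore] -/
theorem transitionKernel_liebRobinson (L : ℕ) [NeZero L] (β' : ℝ)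
    (κ : ℝ≥0 → ProbabilityTheory.Kernel (GaugeConfig 3 L (Matrix.specialUnitaryGroup (Fin 2) ℂ))
      (GaugeConfig 3 L (Matrix.specialUnitaryGroup (Fin 2) ℂ))) [∀ t, ProbabilityTheory.IsMarkovKernel (κ t)]
    (hreal : ∀ (t : ℝ≥0) (x : GaugeConfig 3 L (Matrix.specialUnitaryGroup (Fin 2) ℂ))
        (Ω : Type) [MeasurableSpace Ω] (P : Measure Ω) [IsProbabilityMeasure P]
        (W : ℝ≥0 → Ω → (Edge 3 L × NoiseIdx 2 → ℝ)) (hW : IsFlatBrownian W P)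
        (U : ℝ≥0 → Ω → GaugeConfig 3 L (Matrix.specialUnitaryGroup (Fin 2) ℂ)),
        (∀ ω, U 0 ω = x) →
        (latticeLangevinDynamics (fundamentalLatticeRep 2) β').IsSolution (fundamentalRep (Fin 2))
          hW.natFiltration P W U →
        κ t x = P.map (U t))
    (w : Edge 3 L → ℝ) (hwpos : ∀ e, 0 < w e) (K : ℝ) (hK : 0 ≤ K)
    (hw : ∀ (e : Edge 3 L) (j : Fin 3), j ≠ e.2 →
      w e ≤ K * w (e.1.shift e.2, j) ∧ w e ≤ K * w (e.1.shift j, e.2) ∧ w e ≤ K * w (e.1, j) ∧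
      w e ≤ K * w ((e.1 - Pi.single j 1).shift e.2, j) ∧ w e ≤ K * w (e.1 - Pi.single j 1, e.2) ∧
      w e ≤ K * w (e.1 - Pi.single j 1, j))
    {F : GaugeConfig 3 L (Matrix.specialUnitaryGroup (Fin 2) ℂ) → ℝ} (hFc : Continuous F) (ℓ : Edge 3 L → ℝ)
    (hℓ : ∀ e, 0 ≤ ℓ e)
    (hF : ∀ (e : Edge 3 L) (y y' : GaugeConfig 3 L (Matrix.specialUnitaryGroup (Fin 2) ℂ)), (∀ f, f ≠ e → y f = y' f) →
      |F y - F y'| ≤ ℓ e * frobNorm ((y e : Matrix (Fin 2) (Fin 2) ℂ) - (y' e : Matrix (Fin 2) (Fin 2) ℂ)))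
    (t : ℝ≥0) (x x' : GaugeConfig 3 L (Matrix.specialUnitaryGroup (Fin 2) ℂ)) :
    |∫ y, F y ∂(κ t x) - ∫ y, F y ∂(κ t x')| ≤
      Real.exp (|β'| * (4 + 4 * Real.sqrt 2 + 12 * K) * (t : ℝ)) * (∑ e, ℓ e / w e) *
        ∑ f, w f * frobNorm ((x f : Matrix (Fin 2) (Fin 2) ℂ) - (x' f : Matrix (Fin 2) (Fin 2) ℂ)) := by
  classical
  haveI := secondCountableTopology_su2
  haveI := borelSpace_config L
  -- realise both transition laws by the regular flow on the product Wiener space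
  haveI := isProbabilityMeasure_piWiener (Edge 3 L × NoiseIdx 2)
  have hWc := isFlatBrownian_piWiener 3 L (NoiseIdx 2)
  obtain ⟨U, hU, hLR⟩ := exists_solutionFamily_liebRobinson (L := L) β' hWc
  set P : Measure ((Edge 3 L × NoiseIdx 2) → (ℝ≥0 → ℝ)) := Measure.pi fun _ : Edge 3 L × NoiseIdx 2 => preWienerMeasure with hP
  have hκx : κ t x = P.map (U x t) := hreal t x _ P _ hWc (U x) (hU x).1 (hU x).2
  have hκx' : κ t x' = P.map (U x' t) := hreal t x' _ P _ hWc (U x') (hU x').1 (hU x').2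
  have hmU : ∀ z, Measurable (U z t) := fun z => ((hU z).2.adapted t).mono (hWc.natFiltration.le t) le_rfl
  -- `F` is bounded and measurable
  have hFm : Measurable F := hFc.measurable
  obtain ⟨C, hC⟩ : ∃ C, ∀ y, |F y| ≤ C := by
    obtain ⟨C, hC⟩ := isCompact_univ.exists_bound_of_continuousOn hFc.continuousOn
    exact ⟨C, fun y => by simpa [Real.norm_eq_abs] using hC y (Set.mem_univ y)⟩
  have hint : ∀ z, Integrable (fun ω => F (U z t ω)) P := fun z =>
    Integrable.of_bound (hFm.comp (hmU z)).aestronglyMeasurable C (ae_of_all _ fun ω => by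
      rw [Real.norm_eq_abs]; exact hC _)
  have e1 : ∫ y, F y ∂(κ t x) = ∫ ω, F (U x t ω) ∂P := by
    rw [hκx, integral_map (hmU x).aemeasurable hFm.aestronglyMeasurable]
  have e2 : ∫ y, F y ∂(κ t x') = ∫ ω, F (U x' t ω) ∂P := by
    rw [hκx', integral_map (hmU x').aemeasurable hFm.aestronglyMeasurable]
  rw [e1, e2, ← integral_sub (hint x) (hint x')]
  -- the pathwise bound, almost surely
  set Λr : ℝ := Real.exp (|β'| * (4 + 4 * Real.sqrt 2 + 12 * K) * (t : ℝ)) with hΛr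
  set D₀ : ℝ := ∑ f, w f * frobNorm ((x f : Matrix (Fin 2) (Fin 2) ℂ) - (x' f : Matrix (Fin 2) (Fin 2) ℂ)) with hD₀
  have hD₀' : D₀ = ∑ f, w f * frobNorm ((fundamentalLatticeRep 2).ρ (x f) - (fundamentalLatticeRep 2).ρ (x' f)) := rfl
  have hae : ∀ᵐ ω ∂P, |F (U x t ω) - F (U x' t ω)| ≤ Λr * (∑ e, ℓ e / w e) * D₀ := by
    filter_upwards [hLR w (fun e => (hwpos e).le) K hK hw x x' t] with ω hω
    -- telescoping and the weighted bound
    have htel := abs_sub_le_sum_linkLipschitz ℓ hF (U x t ω) (U x' t ω)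
    set δ : Edge 3 L → ℝ := fun e => frobNorm ((U x t ω e : Matrix (Fin 2) (Fin 2) ℂ) - (U x' t ω e : Matrix (Fin 2) (Fin 2) ℂ))
      with hδ
    have hδ0 : ∀ e, 0 ≤ δ e := fun e => frobNorm_nonneg _
    have hS : ∑ e, w e * δ e ≤ Λr * D₀ := hω
    have hS0 : 0 ≤ ∑ e, w e * δ e := Finset.sum_nonneg fun e _ => mul_nonneg (hwpos e).le (hδ0 e)
    have hterm : ∀ e, ℓ e * δ e ≤ (ℓ e / w e) * ∑ f, w f * δ f := by
      intro e
      have hle : w e * δ e ≤ ∑ f, w f * δ f :=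
        Finset.single_le_sum (f := fun f => w f * δ f) (fun f _ => mul_nonneg (hwpos f).le (hδ0 f)) (Finset.mem_univ e)
      have : ℓ e * δ e = (ℓ e / w e) * (w e * δ e) := by field_simp [(hwpos e).ne']
      rw [this]
      exact mul_le_mul_of_nonneg_left hle (div_nonneg (hℓ e) (hwpos e).le)
    calc |F (U x t ω) - F (U x' t ω)| ≤ ∑ e, ℓ e * δ e := htel
      _ ≤ ∑ e, (ℓ e / w e) * ∑ f, w f * δ f := Finset.sum_le_sum fun e _ => hterm e
      _ = (∑ e, ℓ e / w e) * ∑ f, w f * δ f := by rw [Finset.sum_mul]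
      _ ≤ (∑ e, ℓ e / w e) * (Λr * D₀) :=
          mul_le_mul_of_nonneg_left hS (Finset.sum_nonneg fun e _ => div_nonneg (hℓ e) (hwpos e).le)
      _ = Λr * (∑ e, ℓ e / w e) * D₀ := by ring
  -- integrate
  have hI : Integrable (fun ω => F (U x t ω) - F (U x' t ω)) P := (hint x).sub (hint x')
  calc |∫ ω, (F (U x t ω) - F (U x' t ω)) ∂P| ≤ ∫ ω, |F (U x t ω) - F (U x' t ω)| ∂P :=
        abs_integral_le_integral_abs
    _ ≤ ∫ _ω, Λr * (∑ e, ℓ e / w e) * D₀ ∂P :=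
        integral_mono_ae hI.abs (integrable_const _) hae
    _ = Λr * (∑ e, ℓ e / w e) * D₀ := by
        rw [integral_const, smul_eq_mul, probReal_univ, one_mul]

end Semigroup

end Summit.QuantumFields.YangMills.Theorems.ColdStartUniversality.LiebRobinson
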